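import Mathlib.Analysis.SpecialFunctions.SmoothTransition
import Mathlib.Analysis.Calculus.IteratedDeriv.Lemmas
import Mathlib.Analysis.Calculus.ContDiff.Basic
import Mathlib.Analysis.Calculus.Deriv.Support
import Mathlib.MeasureTheory.Function.LocallyIntegrable
import Mathlib.MeasureTheory.Integral.Bochner.Set
import Mathlib.MeasureTheory.Measure.Lebesgue.Basic
import Mathlib.Analysis.Complex.Basic
import HarnessLib

/-!
# Smooth window functions (flat-top cut-offs) with uniformly bounded derivatives

Topic `Literature/Analysis/Fourier`. A standard device of harmonic analysis: a `C^∞` function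
`f = smoothWindow a b : ℝ → ℂ` with `0 ≤ f ≤ 1`, `f = 1` on `[a + 1, b]`, `f = 0` outside
`(a, b + 1)`, whose `k`-th derivative is bounded by a constant `D_k` depending on `k` only (not on
the window `[a, b]`) and is supported in the two unit "ramps" `[a, a+1] ∪ [b, b+1]`, so that
`∫ |f^{(k)}| ≤ 2 D_k` for `k ≥ 1` uniformly in the window. Such windows (and the decay
`|f̂(r)| ≤ ‖f^{(k)}‖₁ /(2π|r|)^k` of their Fourier transforms, see `SmoothWindowKernel.lean`) are
the "smooth function `f` equal to one on the frequency range, with `f^{(ℓ)} ≪_ℓ 1`" of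
Radziwiłł's Sobolev-type argument ([Radziwill2012], §3), for which this file was written.

Construction: `f(y) = σ(y − a) − σ(y − b)` with `σ = Real.smoothTransition` (Mathlib's smooth
monotone step, `σ = 0` on `(-∞, 0]`, `σ = 1` on `[1, ∞)`), viewed in `ℂ`.

## Main definitions and results (namespace `Literature.Analysis.Fourier`)

* `smoothStep` — `σ` as a complex-valued function; `smoothWindow a b`.
* `smoothWindow_eq_one`, `smoothWindow_eq_zero_of_le`, `smoothWindow_eq_zero_of_ge`,
  `norm_smoothWindow_le_one`, `contDiff_smoothWindow`, `hasCompactSupport_smoothWindow`.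
* `stepDerivBound k` — `D_k = sup |σ^{(k)}|`; `norm_iteratedDeriv_smoothStep_le`.
* `iteratedDeriv_smoothWindow_eq_zero` — `f^{(k)} = 0` on the open flat part `(a+1, b)`, `k ≥ 1`.
* `norm_iteratedDeriv_smoothWindow_le`, `integral_norm_iteratedDeriv_smoothWindow_le` —
  `|f^{(k)}| ≤ D_k (𝟙_{[a,a+1]} + 𝟙_{[b,b+1]})`, `∫|f^{(k)}| ≤ 2 D_k` (`k ≥ 1`);
  `integral_norm_smoothWindow_le` — `∫ |f| ≤ b + 1 − a`.

## References

* [Radziwill2012] M. Radziwiłł, *Limitations to mollifying ζ(s)*, arXiv:1207.6583, §3 (the choice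
  of `f`). The construction itself is folklore.
-/

noncomputable section

open Set MeasureTheory
open scoped ContDiff

namespace Literature.Analysis.Fourier

open _root_.Real (smoothTransition)

/-! ## The smooth step -/

/-- Mathlib's smooth transition `σ` (`= 0` on `(-∞,0]`, `= 1` on `[1,∞)`, monotone, `C^∞`) as a
complex-valued function. [folklore] -/
def smoothStep (x : ℝ) : ℂ := (smoothTransition x : ℂ)

/-- [folklore] -/
lemma smoothStep_apply (x : ℝ) : smoothStep x = (smoothTransition x : ℂ) := rfl

/-- `σ` is `C^∞`. [folklore] -/
theorem contDiff_smoothStep {n : ℕ∞} : ContDiff ℝ n smoothStep :=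
  Complex.ofRealCLM.contDiff.comp _root_.Real.smoothTransition.contDiff

/-- `σ` is continuous. [folklore] -/
@[fun_prop]
theorem continuous_smoothStep : Continuous smoothStep :=
  Complex.continuous_ofReal.comp _root_.Real.smoothTransition.continuous

/-- `σ(x) = 0` for `x ≤ 0`. [folklore] -/
lemma smoothStep_of_nonpos {x : ℝ} (hx : x ≤ 0) : smoothStep x = 0 := by
  simp [smoothStep, _root_.Real.smoothTransition.zero_of_nonpos hx]

/-- `σ(x) = 1` for `x ≥ 1`. [folklore] -/
lemma smoothStep_of_one_le {x : ℝ} (hx : 1 ≤ x) : smoothStep x = 1 := by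
  simp [smoothStep, _root_.Real.smoothTransition.one_of_one_le hx]

/-- For `k ≥ 1`, `σ^{(k)}` vanishes on `(-∞, 0)`. [folklore] -/
lemma iteratedDeriv_smoothStep_of_neg {k : ℕ} (hk : k ≠ 0) {x : ℝ} (hx : x < 0) :
    iteratedDeriv k smoothStep x = 0 := by
  have h : EqOn smoothStep (fun _ => (0 : ℂ)) (Iio 0) := fun y hy => smoothStep_of_nonpos (le_of_lt hy)
  rw [h.iteratedDeriv_of_isOpen isOpen_Iio k hx, iteratedDeriv_const, if_neg hk]

/-- For `k ≥ 1`, `σ^{(k)}` vanishes on `(1, ∞)`. [folklore] -/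
lemma iteratedDeriv_smoothStep_of_one_lt {k : ℕ} (hk : k ≠ 0) {x : ℝ} (hx : 1 < x) :
    iteratedDeriv k smoothStep x = 0 := by
  have h : EqOn smoothStep (fun _ => (1 : ℂ)) (Ioi 1) := fun y hy => smoothStep_of_one_le (le_of_lt hy)
  rw [h.iteratedDeriv_of_isOpen isOpen_Ioi k hx, iteratedDeriv_const, if_neg hk]

/-- `σ^{(k)}` is continuous. [folklore] -/
theorem continuous_iteratedDeriv_smoothStep (k : ℕ) : Continuous (iteratedDeriv k smoothStep) :=
  contDiff_smoothStep.continuous_iteratedDeriv k (by exact_mod_cast le_top)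

/-- For `k ≥ 1`, `σ^{(k)}` is supported in `[0, 1]`. [folklore] -/
lemma support_iteratedDeriv_smoothStep_subset {k : ℕ} (hk : k ≠ 0) :
    Function.support (iteratedDeriv k smoothStep) ⊆ Icc 0 1 := by
  intro x hx
  rw [Function.mem_support] at hx
  by_contra h
  rw [mem_Icc, not_and_or, not_le, not_le] at h
  rcases h with h | h
  · exact hx (iteratedDeriv_smoothStep_of_neg hk h)
  · exact hx (iteratedDeriv_smoothStep_of_one_lt hk h)

/-- For `k ≥ 1`, `σ^{(k)}` has compact support. [folklore] -/
lemma hasCompactSupport_iteratedDeriv_smoothStep {k : ℕ} (hk : k ≠ 0) :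
    HasCompactSupport (iteratedDeriv k smoothStep) :=
  HasCompactSupport.of_support_subset_isCompact isCompact_Icc
    (support_iteratedDeriv_smoothStep_subset hk)

/-- `σ^{(k)}` is bounded (for `k = 0` by `1`, for `k ≥ 1` as a continuous function of compact
support). [folklore] -/
lemma exists_bound_iteratedDeriv_smoothStep (k : ℕ) :
    ∃ C, ∀ x, ‖iteratedDeriv k smoothStep x‖ ≤ C := by
  rcases Nat.eq_zero_or_pos k with rfl | hk
  · refine ⟨1, fun x => ?_⟩
    rw [iteratedDeriv_zero, smoothStep_apply, Complex.norm_real, Real.norm_eq_abs,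
      abs_of_nonneg (_root_.Real.smoothTransition.nonneg x)]
    exact _root_.Real.smoothTransition.le_one x
  · exact (continuous_iteratedDeriv_smoothStep k).bounded_above_of_compact_support
      (hasCompactSupport_iteratedDeriv_smoothStep hk.ne')

/-- `D_k := sup_x |σ^{(k)}(x)|`, a constant depending on `k` only. [folklore] -/
def stepDerivBound (k : ℕ) : ℝ := sSup (Set.range fun x => ‖iteratedDeriv k smoothStep x‖)

/-- `|σ^{(k)}(x)| ≤ D_k`. [folklore] -/
theorem norm_iteratedDeriv_smoothStep_le (k : ℕ) (x : ℝ) :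
    ‖iteratedDeriv k smoothStep x‖ ≤ stepDerivBound k := by
  obtain ⟨C, hC⟩ := exists_bound_iteratedDeriv_smoothStep k
  refine le_csSup ⟨C, ?_⟩ (Set.mem_range_self x)
  rintro _ ⟨y, rfl⟩
  exact hC y

/-- `0 ≤ D_k`. [folklore] -/
lemma stepDerivBound_nonneg (k : ℕ) : 0 ≤ stepDerivBound k :=
  (norm_nonneg _).trans (norm_iteratedDeriv_smoothStep_le k 0)

/-! ## The window -/

/-- The smooth window `f(y) = σ(y − a) − σ(y − b)`: for `a + 1 ≤ b` it vanishes outside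
`(a, b + 1)`, equals `1` on `[a + 1, b]`, and takes values in `[0, 1]`. [folklore] -/
def smoothWindow (a b : ℝ) (y : ℝ) : ℂ := smoothStep (y - a) - smoothStep (y - b)

/-- [folklore] -/
lemma smoothWindow_apply (a b y : ℝ) :
    smoothWindow a b y = smoothStep (y - a) - smoothStep (y - b) := rfl

/-- The window as a difference of two translated steps (as functions). [folklore] -/
lemma smoothWindow_eq (a b : ℝ) :
    smoothWindow a b = (fun y => smoothStep (y - a)) - fun y => smoothStep (y - b) := rfl

/-- The window is `C^∞`. [folklore] -/
theorem contDiff_smoothWindow (a b : ℝ) {n : ℕ∞} : ContDiff ℝ n (smoothWindow a b) := by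
  rw [smoothWindow_eq]
  exact (contDiff_smoothStep.comp (contDiff_id.sub contDiff_const)).sub
    (contDiff_smoothStep.comp (contDiff_id.sub contDiff_const))

/-- The window is continuous. [folklore] -/
theorem continuous_smoothWindow (a b : ℝ) : Continuous (smoothWindow a b) := by
  unfold smoothWindow; fun_prop

/-- `f = 1` on `[a + 1, b]`. [folklore] -/
theorem smoothWindow_eq_one {a b y : ℝ} (h1 : a + 1 ≤ y) (h2 : y ≤ b) : smoothWindow a b y = 1 := by
  rw [smoothWindow_apply, smoothStep_of_one_le (by linarith), smoothStep_of_nonpos (by linarith),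
    sub_zero]

/-- `f = 0` on `(-∞, a]` (when `a ≤ b`). [folklore] -/
theorem smoothWindow_eq_zero_of_le {a b y : ℝ} (hab : a ≤ b) (h : y ≤ a) :
    smoothWindow a b y = 0 := by
  rw [smoothWindow_apply, smoothStep_of_nonpos (by linarith), smoothStep_of_nonpos (by linarith),
    sub_zero]

/-- `f = 0` on `[b + 1, ∞)` (when `a ≤ b`). [folklore] -/
theorem smoothWindow_eq_zero_of_ge {a b y : ℝ} (hab : a ≤ b) (h : b + 1 ≤ y) :
    smoothWindow a b y = 0 := by
  rw [smoothWindow_apply, smoothStep_of_one_le (by linarith), smoothStep_of_one_le (by linarith),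
    sub_self]

/-- The window is real-valued with values in `[0, 1]` (for `a ≤ b`): here `0 ≤ re f ≤ 1` in the
form `f y = ((σ(y−a) − σ(y−b) : ℝ) : ℂ)` with `0 ≤ σ(y−b) ≤ σ(y−a) ≤ 1`. [folklore] -/
theorem norm_smoothWindow_le_one {a b : ℝ} (hab : a ≤ b) (y : ℝ) : ‖smoothWindow a b y‖ ≤ 1 := by
  rw [smoothWindow_apply, smoothStep_apply, smoothStep_apply, ← Complex.ofReal_sub,
    Complex.norm_real, Real.norm_eq_abs]
  have h1 : smoothTransition (y - b) ≤ smoothTransition (y - a) :=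
    _root_.Real.smoothTransition.monotone (by linarith)
  have h2 : smoothTransition (y - a) ≤ 1 := _root_.Real.smoothTransition.le_one _
  have h3 : 0 ≤ smoothTransition (y - b) := _root_.Real.smoothTransition.nonneg _
  rw [abs_of_nonneg (by linarith)]
  linarith

/-- The support of the window lies in `[a, b + 1]` (for `a ≤ b`). [folklore] -/
theorem support_smoothWindow_subset {a b : ℝ} (hab : a ≤ b) :
    Function.support (smoothWindow a b) ⊆ Icc a (b + 1) := by
  intro y hy
  rw [Function.mem_support] at hy
  by_contra h
  rw [mem_Icc, not_and_or, not_le, not_le] at h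
  rcases h with h | h
  · exact hy (smoothWindow_eq_zero_of_le hab h.le)
  · exact hy (smoothWindow_eq_zero_of_ge hab h.le)

/-- The window has compact support (for `a ≤ b`). [folklore] -/
theorem hasCompactSupport_smoothWindow {a b : ℝ} (hab : a ≤ b) :
    HasCompactSupport (smoothWindow a b) :=
  HasCompactSupport.of_support_subset_isCompact isCompact_Icc (support_smoothWindow_subset hab)

/-- The window is integrable (for `a ≤ b`). [folklore] -/
theorem integrable_smoothWindow {a b : ℝ} (hab : a ≤ b) : Integrable (smoothWindow a b) :=
  (continuous_smoothWindow a b).integrable_of_hasCompactSupport (hasCompactSupport_smoothWindow hab)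

/-- `|f| ≤ 𝟙_{[a, b+1]}` pointwise (for `a ≤ b`). [folklore] -/
theorem norm_smoothWindow_le_indicator {a b : ℝ} (hab : a ≤ b) (y : ℝ) :
    ‖smoothWindow a b y‖ ≤ (Icc a (b + 1)).indicator (fun _ => (1 : ℝ)) y := by
  by_cases hy : y ∈ Icc a (b + 1)
  · rw [indicator_of_mem hy]; exact norm_smoothWindow_le_one hab y
  · rw [indicator_of_notMem hy]
    have : smoothWindow a b y = 0 := by
      by_contra h
      exact hy (support_smoothWindow_subset hab (Function.mem_support.2 h))
    rw [this, norm_zero]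

/-- `∫ |f| ≤ b + 1 − a` (for `a ≤ b`). [folklore] -/
theorem integral_norm_smoothWindow_le {a b : ℝ} (hab : a ≤ b) :
    ∫ y, ‖smoothWindow a b y‖ ≤ b + 1 - a := by
  have hle : ∀ y, ‖smoothWindow a b y‖ ≤ (Icc a (b + 1)).indicator (fun _ => (1 : ℝ)) y :=
    norm_smoothWindow_le_indicator hab
  have hint : Integrable fun y => (Icc a (b + 1)).indicator (fun _ => (1 : ℝ)) y :=
    (integrableOn_const (μ := volume) (s := Icc a (b + 1)) (C := (1 : ℝ))
      (by rw [Real.volume_Icc]; exact ENNReal.ofReal_ne_top)).integrable_indicator measurableSet_Icc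
  calc ∫ y, ‖smoothWindow a b y‖ ≤ ∫ y, (Icc a (b + 1)).indicator (fun _ => (1 : ℝ)) y :=
        integral_mono (integrable_smoothWindow hab).norm hint hle
    _ = b + 1 - a := by
        rw [integral_indicator measurableSet_Icc, setIntegral_const, smul_eq_mul, mul_one,
          Real.volume_real_Icc_of_le (by linarith)]

/-! ## Derivatives of the window -/

/-- `f^{(k)}(y) = σ^{(k)}(y − a) − σ^{(k)}(y − b)`. [folklore] -/
theorem iteratedDeriv_smoothWindow (a b : ℝ) (k : ℕ) (y : ℝ) :
    iteratedDeriv k (smoothWindow a b) y =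
      iteratedDeriv k smoothStep (y - a) - iteratedDeriv k smoothStep (y - b) := by
  rw [smoothWindow_eq, iteratedDeriv_sub, iteratedDeriv_comp_sub_const k smoothStep a,
    iteratedDeriv_comp_sub_const k smoothStep b]
  · exact ((contDiff_smoothStep (n := k)).comp (contDiff_id.sub contDiff_const)).contDiffAt
  · exact ((contDiff_smoothStep (n := k)).comp (contDiff_id.sub contDiff_const)).contDiffAt

/-- `f^{(k)}` is continuous. [folklore] -/
theorem continuous_iteratedDeriv_smoothWindow (a b : ℝ) (k : ℕ) :
    Continuous (iteratedDeriv k (smoothWindow a b)) :=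
  (contDiff_smoothWindow a b).continuous_iteratedDeriv k (by exact_mod_cast le_top)

/-- On the open flat part `(a + 1, b)` all derivatives of order `k ≥ 1` vanish. [folklore] -/
theorem iteratedDeriv_smoothWindow_eq_zero {a b : ℝ} {k : ℕ} (hk : k ≠ 0) {y : ℝ}
    (h1 : a + 1 < y) (h2 : y < b) : iteratedDeriv k (smoothWindow a b) y = 0 := by
  rw [iteratedDeriv_smoothWindow, iteratedDeriv_smoothStep_of_one_lt hk (by linarith),
    iteratedDeriv_smoothStep_of_neg hk (by linarith), sub_zero]

/-- For `k ≥ 1`: `|f^{(k)}(y)| ≤ D_k (𝟙_{[a,a+1]}(y) + 𝟙_{[b,b+1]}(y))`. [folklore] -/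
theorem norm_iteratedDeriv_smoothWindow_le {a b : ℝ} {k : ℕ} (hk : k ≠ 0) (y : ℝ) :
    ‖iteratedDeriv k (smoothWindow a b) y‖ ≤
      stepDerivBound k * ((Icc a (a + 1)).indicator (fun _ => (1 : ℝ)) y +
        (Icc b (b + 1)).indicator (fun _ => (1 : ℝ)) y) := by
  rw [iteratedDeriv_smoothWindow]
  have hA : ‖iteratedDeriv k smoothStep (y - a)‖ ≤
      stepDerivBound k * (Icc a (a + 1)).indicator (fun _ => (1 : ℝ)) y := by
    by_cases hy : y ∈ Icc a (a + 1)
    · rw [indicator_of_mem hy, mul_one]; exact norm_iteratedDeriv_smoothStep_le k _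
    · rw [indicator_of_notMem hy, mul_zero]
      have : iteratedDeriv k smoothStep (y - a) = 0 := by
        by_contra h
        have := support_iteratedDeriv_smoothStep_subset hk (Function.mem_support.2 h)
        exact hy ⟨by linarith [this.1], by linarith [this.2]⟩
      rw [this, norm_zero]
  have hB : ‖iteratedDeriv k smoothStep (y - b)‖ ≤
      stepDerivBound k * (Icc b (b + 1)).indicator (fun _ => (1 : ℝ)) y := by
    by_cases hy : y ∈ Icc b (b + 1)
    · rw [indicator_of_mem hy, mul_one]; exact norm_iteratedDeriv_smoothStep_le k _
    · rw [indicator_of_notMem hy, mul_zero]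
      have : iteratedDeriv k smoothStep (y - b) = 0 := by
        by_contra h
        have := support_iteratedDeriv_smoothStep_subset hk (Function.mem_support.2 h)
        exact hy ⟨by linarith [this.1], by linarith [this.2]⟩
      rw [this, norm_zero]
  calc ‖iteratedDeriv k smoothStep (y - a) - iteratedDeriv k smoothStep (y - b)‖
      ≤ ‖iteratedDeriv k smoothStep (y - a)‖ + ‖iteratedDeriv k smoothStep (y - b)‖ :=
        norm_sub_le _ _
    _ ≤ _ := by rw [mul_add]; exact add_le_add hA hB

/-- For `k ≥ 1`, `f^{(k)}` is supported in `[a, a+1] ∪ [b, b+1] ⊆ [a, b+1]` (`a ≤ b`), hence has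
compact support. [folklore] -/
theorem hasCompactSupport_iteratedDeriv_smoothWindow {a b : ℝ} (hab : a ≤ b) (k : ℕ) :
    HasCompactSupport (iteratedDeriv k (smoothWindow a b)) := by
  induction k with
  | zero => simpa using hasCompactSupport_smoothWindow hab
  | succ k ih => rw [iteratedDeriv_succ]; exact ih.deriv

/-- `f^{(k)}` is integrable (`a ≤ b`). [folklore] -/
theorem integrable_iteratedDeriv_smoothWindow {a b : ℝ} (hab : a ≤ b) (k : ℕ) :
    Integrable (iteratedDeriv k (smoothWindow a b)) :=
  (continuous_iteratedDeriv_smoothWindow a b k).integrable_of_hasCompactSupport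
    (hasCompactSupport_iteratedDeriv_smoothWindow hab k)

/-- For `k ≥ 1`: `∫ |f^{(k)}| ≤ 2 D_k`, uniformly in the window. [folklore] -/
theorem integral_norm_iteratedDeriv_smoothWindow_le {a b : ℝ} (hab : a ≤ b) {k : ℕ} (hk : k ≠ 0) :
    ∫ y, ‖iteratedDeriv k (smoothWindow a b) y‖ ≤ 2 * stepDerivBound k := by
  set g : ℝ → ℝ := fun y => stepDerivBound k * ((Icc a (a + 1)).indicator (fun _ => (1 : ℝ)) y +
    (Icc b (b + 1)).indicator (fun _ => (1 : ℝ)) y) with hg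
  have hI1 : Integrable fun y => (Icc a (a + 1)).indicator (fun _ => (1 : ℝ)) y :=
    (integrableOn_const (μ := volume) (s := Icc a (a + 1)) (C := (1 : ℝ))
      (by rw [Real.volume_Icc]; exact ENNReal.ofReal_ne_top)).integrable_indicator measurableSet_Icc
  have hI2 : Integrable fun y => (Icc b (b + 1)).indicator (fun _ => (1 : ℝ)) y :=
    (integrableOn_const (μ := volume) (s := Icc b (b + 1)) (C := (1 : ℝ))
      (by rw [Real.volume_Icc]; exact ENNReal.ofReal_ne_top)).integrable_indicator measurableSet_Icc
  have hgi : Integrable g := (hI1.add hI2).const_mul _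
  calc ∫ y, ‖iteratedDeriv k (smoothWindow a b) y‖ ≤ ∫ y, g y :=
        integral_mono (integrable_iteratedDeriv_smoothWindow hab k).norm hgi
          (norm_iteratedDeriv_smoothWindow_le hk)
    _ = 2 * stepDerivBound k := by
        rw [hg, integral_const_mul, integral_add hI1 hI2, integral_indicator measurableSet_Icc,
          integral_indicator measurableSet_Icc, setIntegral_const, setIntegral_const,
          smul_eq_mul, mul_one, Real.volume_real_Icc_of_le (by linarith),
          Real.volume_real_Icc_of_le (by linarith)]
        ring

end Literature.Analysis.Fourier
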